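import Literature.IUT.HodgeTheaters.PadicFrobenioidTMPairFixedField
import HarnessLib

/-!
# The INNER automorphisms of the `TM`-pair `(Π ↷ 𝒪^⊳_{ℚ̄_p})` of a `p`-adic Frobenioid base and the rigidity they force:
# a pair automorphism lying over conjugation by `γ ∈ Π` IS Galois translation by `φ₁(γ)` on `𝒪^⊳`
# (cell abc-iut, L5 hub node IUTchI:Cor5.3(ii), SUBDAG-IUTchI-Cor53 census cell C53ii/L04 (b), support row «C53ii/N3d
# INNER-GALOIS-TRANSLATION RIGIDITY»; small defs + proofs, sequel to p490952 / p493397 / p494180)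

S. Mochizuki, *Topics in absolute anabelian geometry III*, Def 3.1 (ii) p. 67 («a topological monoid `M` equipped with a
continuous action of `Π` … isomorphisms of topological groups `Π_k ⥲ Π` and of objects `M_k̄ ⥲ M` of `T` that are compatible
with the respective actions»), Prop 3.2 (iv) p. 72 («induces an injection `Isom_{C^MLF_T}((Π ↷ M_T), (Π* ↷ M*_T)) ↪ Isom_TG(Π, Π*)`
… a bijection if `T = TM`») [cite: MochizukiAbsTopIII2015, Definition 3.1 (ii) p.67]; S. Mochizuki, *The geometry of Frobenioids
II*, Thm 2.4 (ii) p. 21 («`Ψ` induces a pair of compatible isomorphisms») [cite: MochizukiFrdII2008, Thm 2.4 (ii) p.21];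
S. Mochizuki, *Inter-universal Teichmüller theory I*, kurims manuscript (May 2020), Cor 5.3 (ii) p. 144 l. 12–15 and proof
l. 33–36 («follows immediately from [AbsTopIII], Proposition 3.2, (iv)») ([IUTchI] Cor 5.3 (ii) p.144)
[claim: Mochizuki2012, status: disputed] (D-0012 claim key — kernel theorems over the cell's typed interfaces; nothing of the
series is asserted, no side is taken on [IUTchIII] Cor. 3.12).

## What this file adds to the N-chain (p490952 → p493397 → p494180 → p494668) and why

The consumer of the N-chain on the L5 hub is the row «C53ii/S2c HMON-AT-REAL-CV» (abc-iut-L1-t7): at the REAL `p`-adic Frobenioid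
`𝒞_v` a self-equivalence `Ψ` lying over an automorphism of the base `𝒟_v` that is INNER (in particular: over the identity) must act
on `𝒪^⊳(−)` by the corresponding Galois translation (abc-iut-L1-t7 FINDING F4 2026-08-27T04:02:49Z: «ψ̄_Ψ = γ·(−) on K̄^× … by Galois
translation»).  The pair-theoretic half of that sentence is supplied here, BY NAME over p493397's binder-free [AbsTopIII] Prop 3.2
(iv) (`tmPairIso_isoM_eq_of_isoPi_eq_of_isOpenHom`):

* `conjEquiv γ` — conjugation by `γ` as an isomorphism of topological groups `Π ⥲ Π`;
* `galUnits σ` — a Galois automorphism `σ ∈ G_{ℚ_p}` on `ℚ̄_p^×`, with its two DISPLAYED [FrdII]-shape properties PROVED: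
  two-sided integrality (`galUnits_norm_le_one_iff`, from abc-iut-L4-t2's `smul_mem_integersClosure`) and equivariance relative to
  `conjEquiv γ` when `σ = φ₁ γ` (`galUnits_hequiv`, the group law);
* `tmPairIsoInner γ` — THE INNER PAIR AUTOMORPHISM of `(Π ↷ 𝒪^⊳_{ℚ̄_p})` determined by `γ ∈ Π`: Galois component `conjEquiv γ`,
  monoid component translation by `φ₁ γ` (p490952's `tmPairIsoOfPair` at these data), with `rfl` read-outs;
* RIGIDITY over any open-image base `φ₁ : Π → G_{ℚ_p}` (abc-iut-L1's `IsOpenHom`, the genuine §2 case):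
  `isoM_apply_eq_galois_of_isoPi_eq_conj` — a pair automorphism whose Galois component is conjugation by `γ` has monoid
  component `x ↦ φ₁(γ)·x` on `𝒪^⊳`; `isoM_apply_eq_self_of_isoPi_eq_refl` — Galois component the identity ⇒ monoid component
  the identity; and, in [FrdII] Thm 2.4 (ii) currency, `psibar_apply_eq_galois_of_conj` — ANY `ψ̄ : ℚ̄_p^× ⥲ ℚ̄_p^×` with the
  displayed (integrality, equivariance-through-`conjEquiv γ`) data IS `u ↦ φ₁(γ)·u` on every non-zero `p`-adic integer
  (`psibar_apply_eq_self_of_refl`: through the identity ⇒ `ψ̄ = id` on `𝒪^⊳`).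

Everything is by NAME (abc-iut-L4-t2 `GaloisMonoidPair.Iso`, `nonzeroIntegers`, `smul_mem_integersClosure`,
`ModelMLFGaloisData.toUnit`; abc-iut-L3-t11 `PadicAlgCl.mem_integersClosure_iff`; abc-iut-L1 `IsOpenHom`; this lineage's
`tmPairOfGaloisHom`, `tmPairIsoOfPair`, `tmPairIso_isoM_eq_of_isoPi_eq_of_isOpenHom`, `psibar_apply_eq_of_galois_eq_of_isOpenHom`);
no instance, no notation, no `Prop` fact, no binder beyond the displayed pair data; the three small `def`s (`conjEquiv`, `galUnits`,
`tmPairIsoInner`) are term constructions.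
HONEST LIMIT: this is the PAIR-LEVEL statement only — how the Ψ-induced `φ` of [FrdII] Thm 2.4 (ii) relates to the base part of a
self-equivalence of the Frobenioid (in particular that «over the identity of `𝒟_v`» yields an inner `φ`) lives in abc-iut-L1's
construction of the pair and is NOT claimed here.  Typed ≠ proved elsewhere; nothing here asserts abc proved or refuted.
-/

noncomputable section

namespace Literature.IUT.HodgeTheaters

open Literature.AlgebraicGeometry.Frobenioids Literature.AlgebraicGeometry.Frobenioids.QuasiTemperoid
open Literature.AnabelianGeometry.AbsoluteAnabelian

namespace PadicTMPair

/-! ### §1. Conjugation as an isomorphism of topological groups -/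

section Conj

variable {G : Type} [Group G] [TopologicalSpace G] [IsTopologicalGroup G]

/-- **Conjugation by `γ`** as an isomorphism of topological groups `Π ⥲ Π`, `g ↦ γ g γ⁻¹` (the inner automorphisms through which
`Isom_TG(Π, Π*)` is read «up to inner automorphisms» in [AbsTopIII] §3). [cite: MochizukiAbsTopIII2015, Definition 3.1 (ii) p.67] -/
def conjEquiv (γ : G) : G ≃ₜ* G :=
  ContinuousMulEquiv.mk
    { toFun := fun g => γ * g * γ⁻¹
      invFun := fun g => γ⁻¹ * g * γ
      left_inv := fun g => by group
      right_inv := fun g => by group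
      map_mul' := fun g h => by group }
    ((continuous_const.mul continuous_id).mul continuous_const)
    ((continuous_const.mul continuous_id).mul continuous_const)

/-- `conjEquiv γ g = γ g γ⁻¹`. [cite: MochizukiAbsTopIII2015, Definition 3.1 (ii) p.67] -/
@[simp] theorem conjEquiv_apply (γ g : G) : conjEquiv γ g = γ * g * γ⁻¹ := rfl

/-- Conjugation by `1` is the identity. [cite: MochizukiAbsTopIII2015, Definition 3.1 (ii) p.67] -/
theorem conjEquiv_one : conjEquiv (1 : G) = ContinuousMulEquiv.refl G :=
  ContinuousMulEquiv.ext fun g => by simp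

end Conj

/-! ### §2. Galois translation on `ℚ̄_p^×` and its two [FrdII]-shape properties -/

section Gal

variable {p : ℕ} [Fact p.Prime]

/-- **A Galois automorphism `σ ∈ G_{ℚ_p}` on the unit group `ℚ̄_p^×`** (`u ↦ σ u`). [cite: MochizukiAbsTopIII2015, Definition 3.1 (i) p.66] -/
def galUnits (σ : GalFbar ℚ_[p]) : (Fbar ℚ_[p])ˣ ≃* (Fbar ℚ_[p])ˣ :=
  Units.mapEquiv (σ : Fbar ℚ_[p] ≃* Fbar ℚ_[p])

/-- On underlying elements `galUnits σ` IS `σ`. [cite: MochizukiAbsTopIII2015, Definition 3.1 (i) p.66] -/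
@[simp] theorem coe_galUnits (σ : GalFbar ℚ_[p]) (u : (Fbar ℚ_[p])ˣ) :
    ((galUnits σ u : (Fbar ℚ_[p])ˣ) : Fbar ℚ_[p]) = σ (u : Fbar ℚ_[p]) := rfl

/-- `galUnits σ` agrees with `Units.map σ` (the spelling of abc-iut-L1's equivariance clauses). [cite: MochizukiAbsTopIII2015, Definition 3.1 (i) p.66] -/
theorem galUnits_eq_map (σ : GalFbar ℚ_[p]) (u : (Fbar ℚ_[p])ˣ) :
    galUnits σ u = Units.map ((σ : GalFbar ℚ_[p]) : Fbar ℚ_[p] →* Fbar ℚ_[p]) u :=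
  Units.ext rfl

/-- **Two-sided integrality of Galois translation** («`G_k` preserves `𝒪^⊳_k̄`», abc-iut-L4-t2's `smul_mem_integersClosure`, read through
abc-iut-L3-t11's `𝒪_{ℚ̄_p} = {‖x‖ ≤ 1}`): `‖u‖ ≤ 1 ⇔ ‖σ u‖ ≤ 1` — the `hint` slot of p490952's `tmPairIsoOfPair`, PROVED for `ψ̄ := σ`.
[cite: MochizukiAbsTopIII2015, Definition 3.1 (i) p.66] -/
theorem galUnits_norm_le_one_iff (σ : GalFbar ℚ_[p]) (u : (Fbar ℚ_[p])ˣ) :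
    ‖(show PadicAlgCl p from (u : Fbar ℚ_[p]))‖ ≤ 1 ↔
      ‖(show PadicAlgCl p from ((galUnits σ u : (Fbar ℚ_[p])ˣ) : Fbar ℚ_[p]))‖ ≤ 1 := by
  rw [← PadicAlgCl.mem_integersClosure_iff, ← PadicAlgCl.mem_integersClosure_iff, coe_galUnits]
  constructor
  · intro h
    exact smul_mem_integersClosure σ h
  · intro h
    have h' := smul_mem_integersClosure σ.symm h
    rwa [AlgEquiv.smul_def, AlgEquiv.symm_apply_apply] at h'

variable {G : Type} [Group G] [TopologicalSpace G] [IsTopologicalGroup G] (φ₁ : G →* GalFbar ℚ_[p])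

/-- **Equivariance of Galois translation through conjugation**: `(φ₁ γ)((φ₁ g) u) = (φ₁ (γ g γ⁻¹))((φ₁ γ) u)` — the `hequiv` slot of
p490952's `tmPairIsoOfPair` for `φ := conjEquiv γ`, `ψ̄ := galUnits (φ₁ γ)`, PROVED (the group law of `G_{ℚ_p}`).
[cite: MochizukiAbsTopIII2015, Definition 3.1 (ii) p.67] -/
theorem galUnits_hequiv (γ g : G) (u : (Fbar ℚ_[p])ˣ) :
    galUnits (φ₁ γ) (Units.map ((φ₁ g : GalFbar ℚ_[p]) : Fbar ℚ_[p] →* Fbar ℚ_[p]) u) =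
      Units.map ((φ₁ (conjEquiv γ g) : GalFbar ℚ_[p]) : Fbar ℚ_[p] →* Fbar ℚ_[p]) (galUnits (φ₁ γ) u) := by
  apply Units.ext
  rw [coe_galUnits, Units.coe_map, Units.coe_map, coe_galUnits, conjEquiv_apply, map_mul, map_mul, map_inv]
  change (φ₁ γ) ((φ₁ g) (u : Fbar ℚ_[p])) = (φ₁ γ * φ₁ g * (φ₁ γ)⁻¹) ((φ₁ γ) (u : Fbar ℚ_[p]))
  rw [AlgEquiv.mul_apply, AlgEquiv.mul_apply, AlgEquiv.aut_inv, AlgEquiv.symm_apply_apply]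

end Gal

/-! ### §3. The inner pair automorphism `tmPairIsoInner γ` of `(Π ↷ 𝒪^⊳_{ℚ̄_p})` -/

section Inner

variable {p : ℕ} [Fact p.Prime] {G : Type} [Group G] [TopologicalSpace G] [IsTopologicalGroup G]
  (φ₁ : G →* GalFbar ℚ_[p]) (hφ₁ : Continuous φ₁)

/-- **THE INNER PAIR AUTOMORPHISM of `(Π ↷ 𝒪^⊳_{ℚ̄_p})` determined by `γ ∈ Π`**: Galois component conjugation by `γ`, monoid component
Galois translation by `φ₁ γ` on `𝒪^⊳` — an automorphism of the [AbsTopIII] Def 3.1 (ii) `TM`-pair `tmPairOfGaloisHom φ₁` (p490952's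
`tmPairIsoOfPair` at `φ := conjEquiv γ`, `ψ̄ := galUnits (φ₁ γ)`, both displayed slots PROVED: `galUnits_norm_le_one_iff`, `galUnits_hequiv`).
[cite: MochizukiAbsTopIII2015, Definition 3.1 (ii) p.67] -/
def tmPairIsoInner (γ : G) : GaloisMonoidPair.Iso (tmPairOfGaloisHom φ₁ hφ₁) (tmPairOfGaloisHom φ₁ hφ₁) :=
  tmPairIsoOfPair φ₁ hφ₁ φ₁ hφ₁ (conjEquiv γ) (galUnits (φ₁ γ)) (galUnits_norm_le_one_iff (φ₁ γ)) (galUnits_hequiv φ₁ γ)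

/-- Its Galois component is conjugation by `γ`. [cite: MochizukiAbsTopIII2015, Definition 3.1 (ii) p.67] -/
theorem tmPairIsoInner_isoPi (γ : G) : (tmPairIsoInner φ₁ hφ₁ γ).isoPi = conjEquiv γ := rfl

/-- Its monoid component, on underlying elements of `ℚ̄_p`, is `x ↦ (φ₁ γ) x`. [cite: MochizukiAbsTopIII2015, Definition 3.1 (ii) p.67] -/
theorem coe_tmPairIsoInner_isoM (γ : G) (x : ↥(nonzeroIntegers ℚ_[p] (Fbar ℚ_[p]))) :
    ((show ↥(nonzeroIntegers ℚ_[p] (Fbar ℚ_[p])) from (tmPairIsoInner φ₁ hφ₁ γ).isoM x) : Fbar ℚ_[p]) = (φ₁ γ) (x : Fbar ℚ_[p]) := rfl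

/-- The monoid component of the identity pair automorphism (abc-iut-L4-t2's `GaloisMonoidPair.Iso.refl`) is the identity on elements.
[cite: MochizukiAbsTopIII2015, Definition 3.1 (ii) p.67] -/
theorem coe_refl_isoM (x : ↥(nonzeroIntegers ℚ_[p] (Fbar ℚ_[p]))) :
    ((show ↥(nonzeroIntegers ℚ_[p] (Fbar ℚ_[p])) from (GaloisMonoidPair.Iso.refl (tmPairOfGaloisHom φ₁ hφ₁)).isoM x) : Fbar ℚ_[p]) =
      (x : Fbar ℚ_[p]) := rfl

end Inner

/-! ### §4. Rigidity over an open-image base: inner Galois component ⇒ Galois translation on `𝒪^⊳` -/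

section Rigidity

variable {p : ℕ} [Fact p.Prime] {G : Type} [Group G] [TopologicalSpace G] [IsTopologicalGroup G]
  (φ₁ : G →* GalFbar ℚ_[p]) (hφ₁ : IsOpenHom φ₁)

include hφ₁ in
/-- **A pair automorphism of `(Π ↷ 𝒪^⊳_{ℚ̄_p})` whose Galois component is conjugation by `γ ∈ Π` IS Galois translation by `φ₁ γ` on
`𝒪^⊳`** — [AbsTopIII] Prop 3.2 (iv) over a genuine §2 base (`φ₁` an open homomorphism), BY NAME of p493397's binder-free
`tmPairIso_isoM_eq_of_isoPi_eq_of_isOpenHom`, compared against `tmPairIsoInner γ`.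
[cite: MochizukiAbsTopIII2015, Proposition 3.2 (iv) p.72] -/
theorem isoM_apply_eq_galois_of_isoPi_eq_conj
    (e : GaloisMonoidPair.Iso (tmPairOfGaloisHom φ₁ (IsOpenHom.continuous hφ₁)) (tmPairOfGaloisHom φ₁ (IsOpenHom.continuous hφ₁)))
    (γ : G) (h : e.isoPi = conjEquiv γ) (x : ↥(nonzeroIntegers ℚ_[p] (Fbar ℚ_[p]))) :
    ((show ↥(nonzeroIntegers ℚ_[p] (Fbar ℚ_[p])) from e.isoM x) : Fbar ℚ_[p]) = (φ₁ γ) (x : Fbar ℚ_[p]) := by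
  have hM := tmPairIso_isoM_eq_of_isoPi_eq_of_isOpenHom φ₁ hφ₁ φ₁ hφ₁ e
    (tmPairIsoInner φ₁ (IsOpenHom.continuous hφ₁) γ) (h.trans (tmPairIsoInner_isoPi φ₁ (IsOpenHom.continuous hφ₁) γ).symm)
  have hx := congrArg (fun f : ↥(nonzeroIntegers ℚ_[p] (Fbar ℚ_[p])) ≃* ↥(nonzeroIntegers ℚ_[p] (Fbar ℚ_[p])) =>
    ((f x : ↥(nonzeroIntegers ℚ_[p] (Fbar ℚ_[p]))) : Fbar ℚ_[p])) hM
  exact hx.trans (coe_tmPairIsoInner_isoM φ₁ (IsOpenHom.continuous hφ₁) γ x)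

include hφ₁ in
/-- **Galois component the identity ⇒ monoid component the identity on `𝒪^⊳`** (the case `γ = 1`: a pair automorphism of
`(Π ↷ 𝒪^⊳_{ℚ̄_p})` over `id_Π` is the identity — the clause a self-equivalence of `𝒞_v` «over the identity of `𝒟_v` ON THE NOSE» lands in).
[cite: MochizukiAbsTopIII2015, Proposition 3.2 (iv) p.72] -/
theorem isoM_apply_eq_self_of_isoPi_eq_refl
    (e : GaloisMonoidPair.Iso (tmPairOfGaloisHom φ₁ (IsOpenHom.continuous hφ₁)) (tmPairOfGaloisHom φ₁ (IsOpenHom.continuous hφ₁)))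
    (h : e.isoPi = ContinuousMulEquiv.refl G) (x : ↥(nonzeroIntegers ℚ_[p] (Fbar ℚ_[p]))) :
    ((show ↥(nonzeroIntegers ℚ_[p] (Fbar ℚ_[p])) from e.isoM x) : Fbar ℚ_[p]) = (x : Fbar ℚ_[p]) := by
  have hM := tmPairIso_isoM_eq_of_isoPi_eq_of_isOpenHom φ₁ hφ₁ φ₁ hφ₁ e
    (GaloisMonoidPair.Iso.refl (tmPairOfGaloisHom φ₁ (IsOpenHom.continuous hφ₁))) h
  have hx := congrArg (fun f : ↥(nonzeroIntegers ℚ_[p] (Fbar ℚ_[p])) ≃* ↥(nonzeroIntegers ℚ_[p] (Fbar ℚ_[p])) =>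
    ((f x : ↥(nonzeroIntegers ℚ_[p] (Fbar ℚ_[p]))) : Fbar ℚ_[p])) hM
  exact hx.trans (coe_refl_isoM φ₁ (IsOpenHom.continuous hφ₁) x)

include hφ₁ in
/-- **[FrdII] Thm 2.4 (ii) currency: a `ψ̄` equivariant THROUGH CONJUGATION BY `γ` is Galois translation by `φ₁ γ` on `𝒪^⊳`.**  For any
group isomorphism `ψ̄ : ℚ̄_p^× ⥲ ℚ̄_p^×` carrying `p`-adic integers exactly onto `p`-adic integers (`hint`) and `Π`-equivariant through
`φ := conjEquiv γ` (`hequiv`, abc-iut-L1's displayed shape), `ψ̄(x) = (φ₁ γ)(x)` for every non-zero `p`-adic integer `x` — this lineage's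
`psibar_apply_eq_of_galois_eq_of_isOpenHom` (p493397) with the comparison pair `ψ̄' := galUnits (φ₁ γ)`, whose displayed slots are the
THEOREMS `galUnits_norm_le_one_iff` / `galUnits_hequiv`.  (The INPUT the S2c row consumes at its last step: «`Ψ` over an inner base
automorphism acts on `𝒪^⊳(−)` by that Galois translation».) ([IUTchI] Cor 5.3 (ii) p.144) [claim: Mochizuki2012, status: disputed] -/
theorem psibar_apply_eq_galois_of_conj (γ : G) (ψbar : (Fbar ℚ_[p])ˣ ≃* (Fbar ℚ_[p])ˣ)
    (hint : ∀ u : (Fbar ℚ_[p])ˣ,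
      ‖(show PadicAlgCl p from (u : Fbar ℚ_[p]))‖ ≤ 1 ↔ ‖(show PadicAlgCl p from ((ψbar u : (Fbar ℚ_[p])ˣ) : Fbar ℚ_[p]))‖ ≤ 1)
    (hequiv : ∀ (g : G) (u : (Fbar ℚ_[p])ˣ),
      ψbar (Units.map ((φ₁ g : GalFbar ℚ_[p]) : Fbar ℚ_[p] →* Fbar ℚ_[p]) u) =
        Units.map ((φ₁ (conjEquiv γ g) : GalFbar ℚ_[p]) : Fbar ℚ_[p] →* Fbar ℚ_[p]) (ψbar u))
    (x : ↥(nonzeroIntegers ℚ_[p] (Fbar ℚ_[p]))) :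
    ψbar (ModelMLFGaloisData.toUnit x) = galUnits (φ₁ γ) (ModelMLFGaloisData.toUnit x) :=
  psibar_apply_eq_of_galois_eq_of_isOpenHom φ₁ hφ₁ φ₁ hφ₁ (conjEquiv γ) ψbar hint hequiv (galUnits (φ₁ γ))
    (galUnits_norm_le_one_iff (φ₁ γ)) (galUnits_hequiv φ₁ γ) x

include hφ₁ in
/-- The same on underlying elements of `ℚ̄_p`: `ψ̄(x) = (φ₁ γ)(x)` for `x ∈ 𝒪^⊳_{ℚ̄_p}`.
([IUTchI] Cor 5.3 (ii) p.144) [claim: Mochizuki2012, status: disputed] -/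
theorem coe_psibar_apply_eq_galois_of_conj (γ : G) (ψbar : (Fbar ℚ_[p])ˣ ≃* (Fbar ℚ_[p])ˣ)
    (hint : ∀ u : (Fbar ℚ_[p])ˣ,
      ‖(show PadicAlgCl p from (u : Fbar ℚ_[p]))‖ ≤ 1 ↔ ‖(show PadicAlgCl p from ((ψbar u : (Fbar ℚ_[p])ˣ) : Fbar ℚ_[p]))‖ ≤ 1)
    (hequiv : ∀ (g : G) (u : (Fbar ℚ_[p])ˣ),
      ψbar (Units.map ((φ₁ g : GalFbar ℚ_[p]) : Fbar ℚ_[p] →* Fbar ℚ_[p]) u) =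
        Units.map ((φ₁ (conjEquiv γ g) : GalFbar ℚ_[p]) : Fbar ℚ_[p] →* Fbar ℚ_[p]) (ψbar u))
    (x : ↥(nonzeroIntegers ℚ_[p] (Fbar ℚ_[p]))) :
    ((ψbar (ModelMLFGaloisData.toUnit x) : (Fbar ℚ_[p])ˣ) : Fbar ℚ_[p]) = (φ₁ γ) (x : Fbar ℚ_[p]) := by
  rw [psibar_apply_eq_galois_of_conj φ₁ hφ₁ γ ψbar hint hequiv x, coe_galUnits]
  rfl

include hφ₁ in
/-- **Through the IDENTITY of `Π`: `ψ̄ = id` on `𝒪^⊳`.**  A `ψ̄` with two-sided integrality that is `Π`-equivariant through the identity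
(`ψ̄((φ₁ g) u) = (φ₁ g)(ψ̄ u)`) fixes every non-zero `p`-adic integer — the `γ = 1` case (`conjEquiv 1 = refl`), compared against
`ψ̄' := galUnits (φ₁ 1) = id`. ([IUTchI] Cor 5.3 (ii) p.144) [claim: Mochizuki2012, status: disputed] -/
theorem coe_psibar_apply_eq_self_of_refl (ψbar : (Fbar ℚ_[p])ˣ ≃* (Fbar ℚ_[p])ˣ)
    (hint : ∀ u : (Fbar ℚ_[p])ˣ,
      ‖(show PadicAlgCl p from (u : Fbar ℚ_[p]))‖ ≤ 1 ↔ ‖(show PadicAlgCl p from ((ψbar u : (Fbar ℚ_[p])ˣ) : Fbar ℚ_[p]))‖ ≤ 1)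
    (hequiv : ∀ (g : G) (u : (Fbar ℚ_[p])ˣ),
      ψbar (Units.map ((φ₁ g : GalFbar ℚ_[p]) : Fbar ℚ_[p] →* Fbar ℚ_[p]) u) =
        Units.map ((φ₁ g : GalFbar ℚ_[p]) : Fbar ℚ_[p] →* Fbar ℚ_[p]) (ψbar u))
    (x : ↥(nonzeroIntegers ℚ_[p] (Fbar ℚ_[p]))) :
    ((ψbar (ModelMLFGaloisData.toUnit x) : (Fbar ℚ_[p])ˣ) : Fbar ℚ_[p]) = (x : Fbar ℚ_[p]) := by
  have hequiv' : ∀ (g : G) (u : (Fbar ℚ_[p])ˣ),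
      ψbar (Units.map ((φ₁ g : GalFbar ℚ_[p]) : Fbar ℚ_[p] →* Fbar ℚ_[p]) u) =
        Units.map ((φ₁ (conjEquiv (1 : G) g) : GalFbar ℚ_[p]) : Fbar ℚ_[p] →* Fbar ℚ_[p]) (ψbar u) := fun g u => by
    rw [conjEquiv_apply, one_mul, inv_one, mul_one]
    exact hequiv g u
  rw [coe_psibar_apply_eq_galois_of_conj φ₁ hφ₁ 1 ψbar hint hequiv' x, map_one, AlgEquiv.one_apply]

end Rigidity

end PadicTMPair

end Literature.IUT.HodgeTheaters

end
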